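import Literature.Analysis.FluidPDE.AncientMildCompactness
import Literature.Analysis.FluidPDE.BoundedL2ClassicalMild
import Literature.Analysis.FluidPDE.KNSSTypeIRateLiouvilleMild
import Literature.Analysis.FluidPDE.ClassicalSolutionRescale
import Summits.NavierStokesRegularity.NavierStokesRegularity.Theorems.HardyPointSinkHardyAncientLimitClassical
import Summits.NavierStokesRegularity.NavierStokesRegularity.Theorems.GaldiLiouvilleGateRecordZoomAncientStubZoomLimit
import Summits.NavierStokesRegularity.NavierStokesRegularity.Theorems.SqueezeCycleSingularZoomEnergy
import Summits.NavierStokesRegularity.NavierStokesRegularity.Theorems.SqueezeCycleSingularZoomData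
import HarnessLib

/-!
# Route FrozenSignCascade · crux `BoundedEnvelopeContinuation` (stmt-NavierStokesRegularity-10579)
# line `registered`, reshape r3 — stub `stub_zoomLimitMorrey` (the KNSS record zoom limit)

**Statement.** Let `(u, p)` be a classical solution of the unforced Navier–Stokes system with
viscosity `ν > 0` on `ℝ³ × [0, T)`, Leray–Hopf from `u 0`, whose slices obey the scale-invariant
Morrey bound `∫_{B_r(x₁)} ‖u t‖² ≤ M r` (`0 < t < T`, `17 r ≤ 1`). Let base times `tc n > 0`,
centres `xc n`, levels `Λ n > 0` and slacks `e n > 0` satisfy `tc n + e n < T`,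
`‖u‖ ≤ 2 Λ n` on `[0, tc n + e n] × ℝ³`, `Λ n → ∞` and `tc n (Λ n)² → ∞`. Then the sup-normalised
viscosity-normalising zooms `z n s y = (Λ n)⁻¹ u(tc n + ν s/(Λ n)², xc n + (ν/Λ n) y)` converge
along a subsequence, pointwise on `(-∞, 0) × ℝ³`, to a bounded ancient mild solution `v` (`ν = 1`)
which is jointly smooth and Oseen-mild on the open past and satisfies
`∫_{B_r(y)} ‖v t‖² ≤ (M/ν²) r` for ALL `t < 0`, `y`, `r > 0`.

**Proof (KNSS 2009, Lemma 6.1; template `RecordZoomAncient.Birth.stub_zoomLimit`).** Each zoom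
is a classical solution with viscosity `1` (`IsClassicalNSSolutionOn.stRescale`) on the window
`(A n, b n)`, `A n = -tc n (Λ n)²/ν → -∞`, `b n = e n (Λ n)²/ν > 0`; on `(A n, b n]` it is bounded
by `2` and has `L²`-bounded slices (Leray–Hopf energy bound and change of variables), so it is
Oseen-mild between negative times (`mild_of_bounded_of_eLpNorm_two_le_of_lt`).
`KNSS2009_lemma61_oseenMild` extracts a pointwise convergent subsequence with an ancient
Oseen-mild limit, which is a bounded ancient mild solution (`isBoundedAncientMildSolution_of_oseen`)
and jointly smooth (`HardyAncientLimit.isSmoothSpaceTimeOn_of_oseen`, KNSS 2009 Prop. 4.1). The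
Morrey bound of the zoom slices is `α² M/R² = M/ν²` at every radius `r` with `(ν/Λ n) r ≤ 1/17`
(`zoom_scaledEnergy_le`), i.e. eventually at every fixed radius since `Λ n → ∞`, and passes to the
pointwise limit by dominated convergence on balls
(`tendsto_setIntegral_ball_norm_sq_of_eventually_bound`).

Sources: G. Koch, N. Nadirashvili, G. Seregin, V. Šverák, Acta Math. 203 (2009) = arXiv:0709.3599,
Lemma 6.1 (p. 11), Prop. 4.1 (p. 8), §6.
-/

noncomputable section

open Set MeasureTheory Filter Topology Function TopologicalSpace Metric
open scoped ENNReal NNReal InnerProductSpace RealInnerProductSpace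
open Literature.Analysis Literature.Analysis.FluidPDE

namespace Summit.NavierStokesRegularity.NavierStokesRegularity.Theorems.BoundedEnvelope

-- the problem-side namespace duplicates `NavierStokesRegularity` by design (D-0017)
set_option linter.dupNamespace false

/-- **stub Z2 — `stub_zoomLimitMorrey` (KNSS 2009, Lemma 6.1: the record zoom limit with the
inherited Morrey bound).** Statement and proof in the module docstring.
[cite: KochNadirashviliSereginSverak2009, Lemma 6.1 and Prop. 4.1 (arXiv:0709.3599)] -/
theorem stub_zoomLimitMorrey :
    ∀ (ν T : ℝ), 0 < ν → 0 < T →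
      ∀ (u : ℝ → EuclideanSpace ℝ (Fin 3) → EuclideanSpace ℝ (Fin 3))
        (p : ℝ → EuclideanSpace ℝ (Fin 3) → ℝ),
        IsClassicalNSSolutionOn (Set.Ico 0 T) ν 0 u p → IsLerayHopfOn T ν 0 (u 0) u →
        ∀ M : ℝ, (∀ t ∈ Set.Ioo 0 T, ∀ (x₁ : EuclideanSpace ℝ (Fin 3)) (r : ℝ), 0 < r → 17 * r ≤ 1 →
            ∫ x in Metric.ball x₁ r, ‖u t x‖ ^ 2 ≤ M * r) →
        ∀ (tc : ℕ → ℝ) (xc : ℕ → EuclideanSpace ℝ (Fin 3)) (Λ e : ℕ → ℝ),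
          (∀ n, 0 < tc n) → (∀ n, 0 < e n) → (∀ n, tc n + e n < T) → (∀ n, 0 < Λ n) →
          (∀ n, ∀ s ∈ Set.Icc 0 (tc n + e n), ∀ x, ‖u s x‖ ≤ 2 * Λ n) →
          Tendsto Λ atTop atTop → Tendsto (fun n => tc n * Λ n ^ 2) atTop atTop →
          ∀ z : ℕ → ℝ → EuclideanSpace ℝ (Fin 3) → EuclideanSpace ℝ (Fin 3),
            (∀ n s y, z n s y = (Λ n)⁻¹ • u (tc n + ν / Λ n ^ 2 * s) (xc n + (ν / Λ n) • y)) →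
            ∃ (φ : ℕ → ℕ) (v : ℝ → EuclideanSpace ℝ (Fin 3) → EuclideanSpace ℝ (Fin 3)),
              StrictMono φ ∧
              (∀ s < 0, ∀ y, Tendsto (fun n => z (φ n) s y) atTop (𝓝 (v s y))) ∧
              IsBoundedAncientMildSolution 1 v ∧
              ContDiffOn ℝ (⊤ : ℕ∞) (uncurry v) (Set.Iio 0 ×ˢ Set.univ) ∧
              (∀ s t : ℝ, s < t → t < 0 → ∀ x,
                v t x = UnboundedOperators.heatExtension (v s) (t - s) x - oseenDuhamel 1 s v v t x) ∧
              (∃ M' : ℝ, ∀ t < 0, ∀ (y : EuclideanSpace ℝ (Fin 3)) (r : ℝ), 0 < r →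
                ∫ x in Metric.ball y r, ‖v t x‖ ^ 2 ≤ M' * r) := by
  intro ν T hν hT u p hcl hLH M hMor tc xc Λ e htc he hte hΛ hdom hΛlim hprod z hz
  -- ### scales `α = Λ⁻¹`, `γ = ν/Λ`, `β = α γ = ν/Λ²` (viscosity `α ν/γ = 1`), windows
  have hαpos : ∀ n, 0 < (Λ n)⁻¹ := fun n => inv_pos.2 (hΛ n)
  have hγpos : ∀ n, 0 < ν / Λ n := fun n => div_pos hν (hΛ n)
  have hβpos : ∀ n, 0 < ν / Λ n ^ 2 := fun n => div_pos hν (pow_pos (hΛ n) 2)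
  obtain ⟨A, hA⟩ : ∃ A : ℕ → ℝ, ∀ n, A n = -(tc n * Λ n ^ 2 / ν) := ⟨_, fun n => rfl⟩
  obtain ⟨b, hb⟩ : ∃ b : ℕ → ℝ, ∀ n, b n = e n * Λ n ^ 2 / ν := ⟨_, fun n => rfl⟩
  have halg : ∀ n s, ν / Λ n ^ 2 = (Λ n)⁻¹ * (ν / Λ n) ∧ (Λ n)⁻¹ * ν / (ν / Λ n) = 1 ∧
      tc n + ν / Λ n ^ 2 * s = ν / Λ n ^ 2 * (s - A n) ∧
      tc n + e n - (tc n + ν / Λ n ^ 2 * s) = ν / Λ n ^ 2 * (b n - s) ∧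
      (Λ n)⁻¹ * (2 * Λ n) = 2 := by
    intro n s
    have hΛn : Λ n ≠ 0 := (hΛ n).ne'
    have hν0 : ν ≠ 0 := hν.ne'
    rw [hA n, hb n]
    refine ⟨?_, ?_, ?_, ?_, ?_⟩ <;> field_simp <;> ring
  have hbpos : ∀ n, 0 < b n := fun n =>
    (hb n).symm ▸ div_pos (mul_pos (he n) (pow_pos (hΛ n) 2)) hν
  have hAneg : ∀ n, A n < 0 := fun n => by
    rw [hA n]; exact neg_neg_of_pos (div_pos (mul_pos (htc n) (pow_pos (hΛ n) 2)) hν)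
  -- original times of rescaled times
  have hmem_Icc : ∀ n s, A n < s → s ≤ b n →
      tc n + ν / Λ n ^ 2 * s ∈ Icc 0 (tc n + e n) := by
    intro n s h1 h2
    obtain ⟨-, -, hoA, hob, -⟩ := halg n s
    have h3 : 0 ≤ ν / Λ n ^ 2 * (s - A n) := mul_nonneg (hβpos n).le (by linarith)
    have h4 : 0 ≤ ν / Λ n ^ 2 * (b n - s) := mul_nonneg (hβpos n).le (by linarith)
    constructor <;> linarith
  have hmem_Ico : ∀ n s, A n < s → s < b n → tc n + ν / Λ n ^ 2 * s ∈ Ico 0 T := by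
    intro n s h1 h2
    have h := hmem_Icc n s h1 h2.le
    exact ⟨h.1, h.2.trans_lt (hte n)⟩
  have hmem_Ioo : ∀ n s, A n < s → s < 0 → tc n + ν / Λ n ^ 2 * s ∈ Ioo 0 (tc n) := by
    intro n s h1 h2
    obtain ⟨-, -, hoA, -, -⟩ := halg n s
    have h3 : 0 < ν / Λ n ^ 2 * (s - A n) := mul_pos (hβpos n) (by linarith)
    have h4 : ν / Λ n ^ 2 * s < 0 := mul_neg_of_pos_of_neg (hβpos n) h2
    constructor <;> linarith
  -- ### the zooms are classical solutions with viscosity `1` on `(A n, b n)`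
  have hzslice : ∀ n s, z n s =
      (Λ n)⁻¹ • fun y => u (tc n + ν / Λ n ^ 2 * s) (xc n + (ν / Λ n) • y) :=
    fun n s => funext fun y => hz n s y
  have hzeq : ∀ n, z n = (Λ n)⁻¹ • stPull (ν / Λ n ^ 2) (ν / Λ n) (tc n) (xc n) u :=
    fun n => funext fun s => funext fun y => by rw [hz n s y]; rfl
  have hclz : ∀ n, IsClassicalNSSolutionOn (Ioo (A n) (b n)) 1 0 (z n)
      ((Λ n)⁻¹ ^ 2 • stPull (ν / Λ n ^ 2) (ν / Λ n) (tc n) (xc n) p) := by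
    intro n
    obtain ⟨hβeq, hvisc, -⟩ := halg n 0
    have h := hcl.stRescale (hαpos n) (hγpos n) hβeq (tc n) (xc n)
    rw [smul_stPull_zero, hvisc, ← hzeq n] at h
    exact h.mono (fun s hs => hmem_Ico n s hs.1 hs.2) (uniqueDiffOn_Ioo _ _)
  have hC1z : ∀ n s, s ∈ Ioo (A n) (b n) → ContDiff ℝ 1 (z n s) := fun n s hs =>
    ((hclz n).contDiff_velocity hs).of_le (by norm_cast)
  -- ### the inputs of KNSS 2009, Lemma 6.1
  have hAlim : Tendsto A atTop atBot := by
    refine (tendsto_neg_atTop_atBot.comp (hprod.atTop_div_const hν)).congr fun n => ?_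
    rw [hA n, Function.comp_apply]
  have hcontz : ∀ n, ContinuousOn (uncurry (z n)) (Ioo (A n) 0 ×ˢ univ) := fun n =>
    (hclz n).smooth_velocity.continuousOn.mono
      (prod_mono (Ioo_subset_Ioo_right (hbpos n).le) subset_rfl)
  have hs_lt_b : ∀ n s, s ≤ 0 → s < b n := fun n s hs => lt_of_le_of_lt hs (hbpos n)
  have hdivz : ∀ n, ∀ s ∈ Ioo (A n) 0, IsWeaklyDivFree (z n s) := fun n s hs =>
    VectorCalculus.IsDivFree.isWeaklyDivFree_holds
      ((hclz n).divFree s ⟨hs.1, hs_lt_b n s hs.2.le⟩) (hC1z n s ⟨hs.1, hs_lt_b n s hs.2.le⟩)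
  have hzb : ∀ n s, A n < s → s ≤ b n → ∀ y, ‖z n s y‖ ≤ 2 := by
    intro n s h1 h2 y
    obtain ⟨-, -, -, -, h2Λ⟩ := halg n s
    rw [hz n s y, norm_smul, Real.norm_of_nonneg (hαpos n).le, ← h2Λ]
    exact mul_le_mul_of_nonneg_left (hdom n _ (hmem_Icc n s h1 h2) _) (hαpos n).le
  have hzb0 : ∀ n s, A n < s → s ≤ 0 → ∀ y, ‖z n s y‖ ≤ 2 := fun n s h1 h2 y =>
    hzb n s h1 (h2.trans (hbpos n).le) y
  -- `L²` bounds of the zoom slices (Leray–Hopf energy bound and change of variables)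
  obtain ⟨E2, hE2top, hE2⟩ : ∃ E2 : ℝ≥0∞, E2 ≠ ∞ ∧ ∀ t ∈ Icc 0 T, eLpNorm (u t) 2 volume ≤ E2 := by
    refine ⟨ENNReal.ofReal (Real.sqrt (2 * VectorCalculus.kineticEnergy (u 0))),
      ENNReal.ofReal_ne_top, fun t ht => (ENNReal.pow_le_pow_left_iff two_ne_zero).1 ?_⟩
    rw [eLpNorm_two_sq_eq_lintegral, ← ENNReal.ofReal_pow (Real.sqrt_nonneg _),
      Real.sq_sqrt (mul_nonneg zero_le_two (kineticEnergy_nonneg _))]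
    exact hLH.lintegral_enorm_sq_le hν.le ht
  have hKz : ∀ n, ∃ K : ℝ≥0∞, K ≠ ∞ ∧ ∀ s, A n < s → s ≤ b n → eLpNorm (z n s) 2 volume ≤ K := by
    intro n
    refine ⟨‖(Λ n)⁻¹‖ₑ *
      (ENNReal.ofReal ((ν / Λ n) ^ Module.finrank ℝ (EuclideanSpace ℝ (Fin 3)))⁻¹ ^
        (1 / (2 : ℝ≥0∞)).toReal * E2), ?_, fun s h1 h2 => ?_⟩
    · exact ENNReal.mul_ne_top enorm_ne_top (ENNReal.mul_ne_top
        (ENNReal.rpow_ne_top_of_nonneg ENNReal.toReal_nonneg ENNReal.ofReal_ne_top) hE2top)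
    · rw [hzslice n s, eLpNorm_const_smul,
        RecordZoomAncient.Birth.eLpNorm_comp_space_affine (hγpos n) (xc n) _ 2]
      gcongr
      have h := hmem_Icc n s h1 h2
      exact hE2 _ ⟨h.1, h.2.trans (hte n).le⟩
  -- the Oseen identity of each zoom between negative times
  have hmildz : ∀ n, ∀ s t : ℝ, A n < s → s < t → t < 0 → ∀ x,
      z n t x = UnboundedOperators.heatExtension (z n s) (t - s) x -
        oseenDuhamel 1 s (z n) (z n) t x := by
    intro n s t h1 h2 h3 x
    obtain ⟨K, hKtop, hK⟩ := hKz n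
    exact mild_of_bounded_of_eLpNorm_two_le_of_lt (hclz n) (h1.trans (h2.trans h3)) (hbpos n)
      (fun τ hτ y => hzb0 n τ hτ.1 hτ.2 y) hKtop (fun τ hτ => hK τ hτ.1 (hτ.2.trans (hbpos n).le))
      h1 h2 h3 x
  -- ### KNSS 2009, Lemma 6.1: the subsequence and the ancient Oseen-mild limit
  obtain ⟨φ, W, hφ, hWc, hWdiv, hWb, hWmild, -, hpt, -⟩ :=
    KNSS2009_lemma61_oseenMild hAlim hcontz hdivz hmildz fun n τ hτ y => hzb0 n τ hτ.1 hτ.2.le y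
  -- bounded ancient mild solution (duality form) and smoothness (KNSS 2009, Prop. 4.1)
  have hmildW : IsBoundedAncientMildSolution 1 W :=
    isBoundedAncientMildSolution_of_oseen one_pos hWc ⟨2, hWb⟩ hWdiv
      (fun s t hst ht x => by rw [one_mul]; exact hWmild s t hst ht x)
  have hsm : IsSmoothSpaceTimeOn (Iio 0) W :=
    HardyAncientLimit.isSmoothSpaceTimeOn_of_oseen hWc zero_le_two hWb hWmild
  -- eventual facts along the subsequence
  have hevA : ∀ s : ℝ, ∀ᶠ j in atTop, A (φ j) < s := fun s =>
    (hAlim.comp hφ.tendsto_atTop).eventually (eventually_lt_atBot s)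
  have hevΛ : ∀ R : ℝ, ∀ᶠ j in atTop, R ≤ Λ (φ j) := fun R =>
    (hΛlim.comp hφ.tendsto_atTop).eventually (eventually_ge_atTop R)
  refine ⟨φ, W, hφ, hpt, hmildW, hsm, hWmild, M / ν ^ 2, fun t ht y r hr => ?_⟩
  -- ### the Morrey bound of the limit slices
  -- the Morrey bound of the zoom slices at radius `r`, eventually
  have hMorz : ∀ᶠ j in atTop, ∫ x in ball y r, ‖z (φ j) t x‖ ^ 2 ≤ M / ν ^ 2 * r := by
    filter_upwards [hevA t, hevΛ (17 * ν * r)] with j hjA hjΛ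
    set n := φ j with hn
    -- the zoom in the form of `zoom_scaledEnergy_le` (factor `c = 1`)
    have hform : z n t = ((1 * (Λ n)⁻¹) • stPull (1 ^ 2 * (ν / Λ n ^ 2)) (1 * (ν / Λ n))
        (tc n) (xc n) u) t := by
      funext x
      rw [hz n t x, smul_stPull_apply, one_mul, one_pow, one_mul, one_mul]
    have hMor' : ∀ t' ∈ Ioo 0 (tc n), ∀ (x₁ : EuclideanSpace ℝ (Fin 3)) (ρ : ℝ), 0 < ρ →
        ρ ≤ 1 / 17 → ∫ x in ball x₁ ρ, ‖u t' x‖ ^ 2 ≤ M * ρ := fun t' ht' x₁ ρ hρ hρ' =>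
      hMor t' ⟨ht'.1, ht'.2.trans ((lt_add_of_pos_right _ (he n)).trans (hte n))⟩ x₁ ρ hρ
        (by linarith)
    have hs : tc n + 1 ^ 2 * (ν / Λ n ^ 2) * t ∈ Ioo 0 (tc n) := by
      rw [one_pow, one_mul]; exact hmem_Ioo n t hjA ht
    have hrr : 1 * (ν / Λ n) * r ≤ 1 / 17 := by
      rw [one_mul, div_mul_eq_mul_div, div_le_div_iff₀ (hΛ n) (by norm_num : (0 : ℝ) < 17)]
      linarith
    have h := zoom_scaledEnergy_le (T := tc n) (x₀ := xc n) (u := u) (α := (Λ n)⁻¹)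
      (β := ν / Λ n ^ 2) (hγpos n) one_pos hMor' hs y hr hrr
    rw [← hform] at h
    have hcst : (Λ n)⁻¹ ^ 2 * M / (ν / Λ n) ^ 2 = M / ν ^ 2 := by
      have hΛn : Λ n ≠ 0 := (hΛ n).ne'
      field_simp
    rw [hcst] at h
    have h' := mul_le_mul_of_nonneg_left h hr.le
    rwa [← mul_assoc, mul_inv_cancel₀ hr.ne', one_mul, mul_comm r] at h'
  -- continuity and the bound `2` of the zoom slices at time `t`, eventually
  have hf : ∀ᶠ j in atTop, Continuous (z (φ j) t) ∧ ∀ x, ‖z (φ j) t x‖ ≤ 2 := by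
    filter_upwards [hevA t] with j hjA
    exact ⟨(hC1z _ t ⟨hjA, hs_lt_b _ t ht.le⟩).continuous, fun x => hzb0 _ t hjA ht.le x⟩
  exact le_of_tendsto (tendsto_setIntegral_ball_norm_sq_of_eventually_bound hf (hpt t ht) y r)
    hMorz

end Summit.NavierStokesRegularity.NavierStokesRegularity.Theorems.BoundedEnvelope

end
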